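import Mathlib
import HarnessLib
import Summits.HubbardSuperconductivity.HubbardSuperconductivity.Theorems.KLProgrammeKLRegimeEngineV8DefsU12
import Summits.HubbardSuperconductivity.HubbardSuperconductivity.Theorems.KLProgrammeKLRegimeEngineV8DefsG11Hosting
import Summits.HubbardSuperconductivity.HubbardSuperconductivity.Theorems.KLProgrammeKLRegimeEngineV8IsoMomentRow
import Summits.HubbardSuperconductivity.HubbardSuperconductivity.Theorems.KLProgrammeKLRegimeEngineV8DefsG8
import Summits.HubbardSuperconductivity.HubbardSuperconductivity.Theorems.KLProgrammeKLRegimeEngineV8DefsFrU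
import Summits.HubbardSuperconductivity.HubbardSuperconductivity.Theorems.KLProgrammeKLRegimeEngineV8PairTransferExport7
import Summits.HubbardSuperconductivity.HubbardSuperconductivity.Theorems.KLProgrammeKLRegimeEngineLastRespDefs
import Summits.HubbardSuperconductivity.HubbardSuperconductivity.Theorems.KLProgrammeKLRegimeEngineV8TwoLegSpaceMomentsExport
import Summits.HubbardSuperconductivity.HubbardSuperconductivity.Theorems.KLProgrammeKLRegimeEngineV8GridLiteralsPkg
import Summits.HubbardSuperconductivity.HubbardSuperconductivity.Theorems.KLProgrammeKLRegimeEngineV8GridLiterals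
import Summits.HubbardSuperconductivity.HubbardSuperconductivity.Theorems.KLProgrammeKLRegimeTwoLegReadOscConsts
import Summits.HubbardSuperconductivity.HubbardSuperconductivity.Theorems.KLProgrammeKLRegimeEngineV8TowerCEDefsC
import Summits.HubbardSuperconductivity.HubbardSuperconductivity.Theorems.KLProgrammeKLRegimeEngineV8TowerCoreDefsC

/-!
# K3 ENGINE package, U-level v12 — TOKEN #14 `klEngU₀12` = the CORE `klEngU₀12Core` (p594660) ⊓ the U12b ENTRIES AT THE rev-13 TOKENS
# (text by the 20437 registrant p1b g14 from wake AMENDMENTS 15/18/19 of `WAKE-hubbard-kl-k3c2-p1-20260827T2110Z.md` + rev 14 «…-M5» (`klZspU5`) + pen (R174)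
# «(b)-GRID-DEFERRED» (the grid-literal U-rows); owner of record = the k3c2-p1 lineage, filed by the registrant substitute in the (R174) night window 23:00Z–05:00Z 08-28/29
# (pen (R135)/(R174)) unless k3c2-p1 is seated; any post-18:00Z entry the branch word adds goes at the END of the min-chain)

WHAT.  `klEngU₀12 P R cc := klEngU₀12Core P R cc ⊓ klIsoMomU klEngGeo11 P R (klEngQ9c P R) cc ⊓ klE4UF klEngGeo11 P R (klEngQ9c P R) cc ⊓ klE5FrU klEngGeo11 R
  ⊓ klCTu7 P R (klEngQ7 P R) klEngGeo11 klEngGeoTh (klEngQ9c P R) cc ⊓ klE5RowsU11 P R ⊓ klTSU R ⊓ klLastRespU P R ⊓ klZspU5 P R (klEngQ7 P R) klEngGeo11 (klEngQ9c P R) cc`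
(FULL variant under «(b)-GRID-DEFERRED»: + `klZspU5` (#17, p618321) + `klGridLitUAt` + the (e) closer's `klTwoLegMomU R (klZt P R) (klZs2 P R)` / `1/(64(|klZs2|+1))` /
`R.cz/(1200(klZs1+1))` / `1/(20(klZs1+1))` rows keyed on the DEFERRED literals of `…EngineV8GridLiteralsPkg` + `klGridU₀ R` (GridLiterals part 1) = AMENDMENT 15 item 1 COMPLETE
+ AMENDMENT 21 (pen (R190)): `⊓ 1/(klReadOscC P R + 1)` — the mean-free consumers' door `klReadOscC·U ≤ 1`
+ AMENDMENT 22 (pen (R191)): `⊓ klTailBookU` (`:= 1/10³⁰⁰` per p1 g21, the (C) n = 0 tail-row booking door))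
+ AMENDMENT 23 (pen (R202), «(ℓ)-C-SLOT», CONDITIONAL GO/NO-GO 23:00Z 08-28): `⊓ klTowerUC P R (klEngQ9c P R) cc` — the c-slotted tower package's U-threshold (`…EngineV8TowerCEDefsC`, k3c3-p2 g13)
  and (registrant (J3)/(J4)) `⊓ klTowerCoreUC9 P R (klEngQ9c P R) cc` — the capped atom-free core-C package's U-threshold (`…EngineV8TowerCoreDefsC`)
(AMENDMENT 18's six entries at the FINAL tokens `(klEngGeo11, klEngQ9c P R, klEngGeoTh)` + AMENDMENT 19's `klLastRespU P R` (condition met 04:58Z 08-28, p605936));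
one `klEngU₀12_le_<entry>` projection per entry, `klEngU₀12_le_klEngU₀12Core` and through it the core rows the v2 composition §C reads BY NAME
(`klEngU₀12_le_klEngU₀10`, `klEngU₀12_le_klCUu2`, `klEngU₀12_le_klE5uM`), `klEngU₀12_pos (hP : P.WF) (hR : R.WF2)`, and the lift chain `≤ klEngU₀10 ≤ klEngU₀9 ≤ klEngU₀3`.
The core's G10-keyed rows (`klIsoMomU/klE4UF … klEngGeo10`, `klE5RowsU10`, `klCTu5`) stay in the core as orphans (AMENDMENT 18: do NOT remove them); U12b adds the
G11-keyed twins.  POST-18:00Z ENTRIES (AMENDMENT 15 item 1 / AMENDMENT 18 tail — NOT in this pre-build, add at filing time if typed by then, each with its `_le_`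
row and a `_pos` conjunct): the #28 U-components keyed on `klZs1` / `klTwoLegMomU R (klZt P R) (klZs2 P R)` / `1/(64(|klZs2 P R|+1))` (GridLiterals part 2), `klGridU₀ R`,
the tower-grid / `klTowerCE` entry, any named class-#5 U-door numeral.

Definitions with bodies + order lemmas; nothing about the model is asserted; nothing asserts any stub of 20437, K3 or superconductivity.
-/

noncomputable section

namespace Summit.HubbardSuperconductivity.HubbardSuperconductivity.Theorems.EngineV8

set_option linter.dupNamespace false -- summit = problem name (single-conjunct summit), D-0017

open Real Finset Literature.MathematicalPhysics.QuantumLattice Literature.Probability.LatticeModels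
open Summit.HubbardSuperconductivity.HubbardSuperconductivity.Theorems.KLRegimeSplit
open Summit.HubbardSuperconductivity.HubbardSuperconductivity.Theorems.KLProgrammeLegKernels
open Summit.HubbardSuperconductivity.HubbardSuperconductivity.Theorems.DispersionFlow

/-! ## §1 Token #14 -/

/-- **`klTailBookU := 1/10³⁰⁰`** (exponent 300 per p1 g21's Abel-route sizing, KL STATUS 13:01Z 08-28: k = 4 needs ≥ 207 at λ = 1; pen (R191) default 120 superseded upward) — tail-row booking door for stub (C) n = 0, rows `hToff k`, `k ≤ 4` (pen (R191) AMENDMENT 22, located «(C)-TAIL-ROWS-BUDGET»): books `U³ ≤ U²·klTailBookU`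
so that the analytic weighted sizes `a_k` book under `hfit3/hfit4`; ANY positive value serves H1 (`∃ U₀ > 0`); improvable post-T by peeling the explicit third order or certifying `a_k`. -/
def klTailBookU : ℝ := 1 / 10 ^ 300

/-- `0 < klTailBookU`. -/
theorem klTailBookU_pos : 0 < klTailBookU := by unfold klTailBookU; positivity

/-- **`klEngU₀12 P R cc`** — token #14 of the v2 FREEZE: the core `klEngU₀12Core P R cc` (p594660) capped by the U12b entries at the rev-13 tokens — class #6
moment row `klIsoMomU` and class #4 `klE4UF` re-keyed at `(klEngGeo11, klEngQ9c P R)`, the (F)(i) insurance `klE5FrU klEngGeo11 R`, class #5 «REL-DIRECT»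
`klCTu7 … klEngGeo11 klEngGeoTh …`, the (c)-E5 rows entry `klE5RowsU11`, the two-shell witness door `klTSU R` (DefsG11), and #20's last-step response door
`klLastRespU P R` (AMENDMENT 19); FULL «(b)-GRID-DEFERRED» entries, AMENDMENTS 21/22 and (AMENDMENT 23) the c-slotted tower thresholds `klTowerUC P R (klEngQ9c P R) cc`, `klTowerCoreUC9 P R (klEngQ9c P R) cc` LAST. -/
def klEngU₀12 (P : SplitConsts) (R : RenConsts) (cc : ℝ) : ℝ :=
  min (klEngU₀12Core P R cc)
    (min (klIsoMomU klEngGeo11 P R (klEngQ9c P R) cc)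
      (min (klE4UF klEngGeo11 P R (klEngQ9c P R) cc)
        (min (klE5FrU klEngGeo11 R)
          (min (klCTu7 P R (klEngQ7 P R) klEngGeo11 klEngGeoTh (klEngQ9c P R) cc)
            (min (klE5RowsU11 P R)
              (min (klTSU R) (min (klLastRespU P R) (min (klZspU5 P R (klEngQ7 P R) klEngGeo11 (klEngQ9c P R) cc)
                (min (klGridLitUAt P R (klEngQ9c P R) cc) (min (klTwoLegMomU R (klZt P R) (klZs2 P R))
                  (min (1 / (64 * (|klZs2 P R| + 1))) (min (R.cz / (1200 * (klZs1 P R + 1))) (min (1 / (20 * (klZs1 P R + 1))) (min (klGridU₀ R) (min (1 / (klReadOscC P R + 1)) (min klTailBookU (min (klTowerUC P R (klEngQ9c P R) cc) (klTowerCoreUC9 P R (klEngQ9c P R) cc))))))))))))))))))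

section Projections

variable (P : SplitConsts) (R : RenConsts) (cc : ℝ)

/-- `klEngU₀12 ≤ klEngU₀12Core`. -/
theorem klEngU₀12_le_klEngU₀12Core : klEngU₀12 P R cc ≤ klEngU₀12Core P R cc := min_le_left _ _

/-- `klEngU₀12 ≤ klIsoMomU klEngGeo11 P R (klEngQ9c P R) cc` (class #6 «G10-MOM» moment-package threshold at the G11 token; §C row). -/
theorem klEngU₀12_le_klIsoMomU : klEngU₀12 P R cc ≤ klIsoMomU klEngGeo11 P R (klEngQ9c P R) cc := (min_le_right _ _).trans (min_le_left _ _)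

/-- `klEngU₀12 ≤ klE4UF klEngGeo11 P R (klEngQ9c P R) cc` (class #4 (E4) flow threshold at the G11 token). -/
theorem klEngU₀12_le_klE4UF : klEngU₀12 P R cc ≤ klE4UF klEngGeo11 P R (klEngQ9c P R) cc :=
  (min_le_right _ _).trans ((min_le_right _ _).trans (min_le_left _ _))

/-- `klEngU₀12 ≤ klE5FrU klEngGeo11 R` ((F)(i) insurance at the G11 token). -/
theorem klEngU₀12_le_klE5FrU : klEngU₀12 P R cc ≤ klE5FrU klEngGeo11 R :=
  (min_le_right _ _).trans ((min_le_right _ _).trans ((min_le_right _ _).trans (min_le_left _ _)))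

/-- `klEngU₀12 ≤ klCTu7 P R (klEngQ7 P R) klEngGeo11 klEngGeoTh (klEngQ9c P R) cc` (class #5 «REL-DIRECT» threshold; §C row). -/
theorem klEngU₀12_le_klCTu7 : klEngU₀12 P R cc ≤ klCTu7 P R (klEngQ7 P R) klEngGeo11 klEngGeoTh (klEngQ9c P R) cc :=
  (min_le_right _ _).trans ((min_le_right _ _).trans ((min_le_right _ _).trans ((min_le_right _ _).trans (min_le_left _ _))))

/-- `klEngU₀12 ≤ klE5RowsU11 P R` ((c)-E5 accumulated-rows entry at the G11 token). -/
theorem klEngU₀12_le_klE5RowsU11 : klEngU₀12 P R cc ≤ klE5RowsU11 P R :=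
  (min_le_right _ _).trans ((min_le_right _ _).trans ((min_le_right _ _).trans ((min_le_right _ _).trans ((min_le_right _ _).trans (min_le_left _ _)))))

/-- `klEngU₀12 ≤ klTSU R` (the two-shell witness U-door of DefsG11). -/
theorem klEngU₀12_le_klTSU : klEngU₀12 P R cc ≤ klTSU R :=
  (min_le_right _ _).trans ((min_le_right _ _).trans ((min_le_right _ _).trans ((min_le_right _ _).trans ((min_le_right _ _).trans
    ((min_le_right _ _).trans (min_le_left _ _))))))

/-- `klEngU₀12 ≤ klLastRespU P R` (#20 (δ′) last-step response door, AMENDMENT 19). -/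
theorem klEngU₀12_le_klLastRespU : klEngU₀12 P R cc ≤ klLastRespU P R :=
  (min_le_right _ _).trans ((min_le_right _ _).trans ((min_le_right _ _).trans ((min_le_right _ _).trans ((min_le_right _ _).trans
    ((min_le_right _ _).trans ((min_le_right _ _).trans (min_le_left _ _)))))))

/-- `klEngU₀12 ≤ klZspU5 P R (klEngQ7 P R) klEngGeo11 (klEngQ9c P R) cc` (#17 «(C2)-MOMENTS» producer threshold of rev 14 «…-M5», p618321). -/
theorem klEngU₀12_le_klZspU5 : klEngU₀12 P R cc ≤ klZspU5 P R (klEngQ7 P R) klEngGeo11 (klEngQ9c P R) cc :=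
  (min_le_right _ _).trans ((min_le_right _ _).trans ((min_le_right _ _).trans ((min_le_right _ _).trans ((min_le_right _ _).trans ((min_le_right _ _).trans ((min_le_right _ _).trans ((min_le_right _ _).trans (min_le_left _ _))))))))

/-- `klEngU₀12 ≤ klGridLitUAt P R (klEngQ9c P R) cc` (the grid-literal producer's threshold, «(b)-GRID-DEFERRED»). -/
theorem klEngU₀12_le_klGridLitUAt : klEngU₀12 P R cc ≤ klGridLitUAt P R (klEngQ9c P R) cc :=
  (min_le_right _ _).trans ((min_le_right _ _).trans ((min_le_right _ _).trans ((min_le_right _ _).trans ((min_le_right _ _).trans ((min_le_right _ _).trans ((min_le_right _ _).trans ((min_le_right _ _).trans ((min_le_right _ _).trans (min_le_left _ _)))))))))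

/-- `klEngU₀12 ≤ klTwoLegMomU R (klZt P R) (klZs2 P R)` (the (e) closer's `hUm`). -/
theorem klEngU₀12_le_klTwoLegMomU : klEngU₀12 P R cc ≤ klTwoLegMomU R (klZt P R) (klZs2 P R) :=
  (min_le_right _ _).trans ((min_le_right _ _).trans ((min_le_right _ _).trans ((min_le_right _ _).trans ((min_le_right _ _).trans ((min_le_right _ _).trans ((min_le_right _ _).trans ((min_le_right _ _).trans ((min_le_right _ _).trans ((min_le_right _ _).trans (min_le_left _ _))))))))))

/-- `klEngU₀12 ≤ 1/(64·(|klZs2 P R|+1))` (the (e) closer's `hUq`). -/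
theorem klEngU₀12_le_inv_klZs2 : klEngU₀12 P R cc ≤ 1 / (64 * (|klZs2 P R| + 1)) :=
  (min_le_right _ _).trans ((min_le_right _ _).trans ((min_le_right _ _).trans ((min_le_right _ _).trans ((min_le_right _ _).trans ((min_le_right _ _).trans ((min_le_right _ _).trans ((min_le_right _ _).trans ((min_le_right _ _).trans ((min_le_right _ _).trans ((min_le_right _ _).trans (min_le_left _ _)))))))))))

/-- `klEngU₀12 ≤ R.cz/(1200·(klZs1 P R+1))` (#28 U-row, `klZs1_mixedRow_of_doors`'s `hU2`). -/
theorem klEngU₀12_le_cz_klZs1 : klEngU₀12 P R cc ≤ R.cz / (1200 * (klZs1 P R + 1)) :=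
  (min_le_right _ _).trans ((min_le_right _ _).trans ((min_le_right _ _).trans ((min_le_right _ _).trans ((min_le_right _ _).trans ((min_le_right _ _).trans ((min_le_right _ _).trans ((min_le_right _ _).trans ((min_le_right _ _).trans ((min_le_right _ _).trans ((min_le_right _ _).trans ((min_le_right _ _).trans (min_le_left _ _))))))))))))

/-- `klEngU₀12 ≤ 1/(20·(klZs1 P R+1))` (#28 U-row, `hU3`). -/
theorem klEngU₀12_le_inv_klZs1 : klEngU₀12 P R cc ≤ 1 / (20 * (klZs1 P R + 1)) :=
  (min_le_right _ _).trans ((min_le_right _ _).trans ((min_le_right _ _).trans ((min_le_right _ _).trans ((min_le_right _ _).trans ((min_le_right _ _).trans ((min_le_right _ _).trans ((min_le_right _ _).trans ((min_le_right _ _).trans ((min_le_right _ _).trans ((min_le_right _ _).trans ((min_le_right _ _).trans ((min_le_right _ _).trans (min_le_left _ _)))))))))))))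

/-- `klEngU₀12 ≤ klGridU₀ R` (GridLiterals part 1 producer U-row). -/
theorem klEngU₀12_le_klGridU₀ : klEngU₀12 P R cc ≤ klGridU₀ R :=
  (min_le_right _ _).trans ((min_le_right _ _).trans ((min_le_right _ _).trans ((min_le_right _ _).trans ((min_le_right _ _).trans ((min_le_right _ _).trans ((min_le_right _ _).trans ((min_le_right _ _).trans ((min_le_right _ _).trans ((min_le_right _ _).trans ((min_le_right _ _).trans ((min_le_right _ _).trans ((min_le_right _ _).trans ((min_le_right _ _).trans (min_le_left _ _))))))))))))))

/-- `klEngU₀12 ≤ 1/(klReadOscC P R + 1)` (AMENDMENT 21, pen (R190): the mean-free consumers' door `klReadOscC·U ≤ 1`, via `1/(c+1) ≤ 1/max(c,1)`). -/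
theorem klEngU₀12_le_inv_klReadOscC : klEngU₀12 P R cc ≤ 1 / (klReadOscC P R + 1) :=
  (min_le_right _ _).trans ((min_le_right _ _).trans ((min_le_right _ _).trans ((min_le_right _ _).trans ((min_le_right _ _).trans ((min_le_right _ _).trans ((min_le_right _ _).trans ((min_le_right _ _).trans ((min_le_right _ _).trans ((min_le_right _ _).trans ((min_le_right _ _).trans ((min_le_right _ _).trans ((min_le_right _ _).trans ((min_le_right _ _).trans ((min_le_right _ _).trans (min_le_left _ _)))))))))))))))

/-- `klEngU₀12 ≤ klTailBookU` (AMENDMENT 22, pen (R191): the (C) n = 0 tail-row booking door). -/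
theorem klEngU₀12_le_klTailBookU : klEngU₀12 P R cc ≤ klTailBookU :=
  (min_le_right _ _).trans ((min_le_right _ _).trans ((min_le_right _ _).trans ((min_le_right _ _).trans ((min_le_right _ _).trans ((min_le_right _ _).trans ((min_le_right _ _).trans ((min_le_right _ _).trans ((min_le_right _ _).trans ((min_le_right _ _).trans ((min_le_right _ _).trans ((min_le_right _ _).trans ((min_le_right _ _).trans ((min_le_right _ _).trans ((min_le_right _ _).trans ((min_le_right _ _).trans (min_le_left _ _))))))))))))))))

/-- `klEngU₀12 ≤ klTowerUC P R (klEngQ9c P R) cc` (AMENDMENT 23, pen (R202) «(ℓ)-C-SLOT»: the c-slotted tower package's U-threshold; the (b) closer's `hUle.trans (klEngU₀12_le_klTowerUC P R c)`). -/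
theorem klEngU₀12_le_klTowerUC : klEngU₀12 P R cc ≤ klTowerUC P R (klEngQ9c P R) cc :=
  (min_le_right _ _).trans ((min_le_right _ _).trans ((min_le_right _ _).trans ((min_le_right _ _).trans ((min_le_right _ _).trans ((min_le_right _ _).trans ((min_le_right _ _).trans ((min_le_right _ _).trans ((min_le_right _ _).trans ((min_le_right _ _).trans ((min_le_right _ _).trans ((min_le_right _ _).trans ((min_le_right _ _).trans ((min_le_right _ _).trans ((min_le_right _ _).trans ((min_le_right _ _).trans ((min_le_right _ _).trans (min_le_left _ _)))))))))))))))))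

/-- `klEngU₀12 ≤ klTowerCoreUC9 P R (klEngQ9c P R) cc` (AMENDMENT 23, registrant (J3)/(J4): the capped core-C package's U-threshold; the (b) closer feeds
`towerCoreC9_at_klEngQ9c`'s `hUu` as `hUle.trans (klEngU₀12_le_klTowerCoreUC9 P R c)`). -/
theorem klEngU₀12_le_klTowerCoreUC9 : klEngU₀12 P R cc ≤ klTowerCoreUC9 P R (klEngQ9c P R) cc :=
  (min_le_right _ _).trans ((min_le_right _ _).trans ((min_le_right _ _).trans ((min_le_right _ _).trans ((min_le_right _ _).trans ((min_le_right _ _).trans ((min_le_right _ _).trans ((min_le_right _ _).trans ((min_le_right _ _).trans ((min_le_right _ _).trans ((min_le_right _ _).trans ((min_le_right _ _).trans ((min_le_right _ _).trans ((min_le_right _ _).trans ((min_le_right _ _).trans ((min_le_right _ _).trans ((min_le_right _ _).trans (min_le_right _ _)))))))))))))))))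


/-! ### the core rows the composition §C reads by name, lifted through `klEngU₀12_le_klEngU₀12Core` -/

/-- **THE #14 LIFT LINE**: `klEngU₀12 ≤ klEngU₀10`. -/
theorem klEngU₀12_le_klEngU₀10 : klEngU₀12 P R cc ≤ klEngU₀10 P R cc := (klEngU₀12_le_klEngU₀12Core P R cc).trans (klEngU₀12Core_le_klEngU₀10 P R cc)

/-- `klEngU₀12 ≤ klCUu2 P R (klEngQ7 P R) (klEngQ9c P R) cc` (class #1). -/
theorem klEngU₀12_le_klCUu2 : klEngU₀12 P R cc ≤ klCUu2 P R (klEngQ7 P R) (klEngQ9c P R) cc :=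
  (klEngU₀12_le_klEngU₀12Core P R cc).trans (klEngU₀12Core_le_klCUu2 P R cc)

/-- `klEngU₀12 ≤ klE5uM P R` (class #6 fit input). -/
theorem klEngU₀12_le_klE5uM : klEngU₀12 P R cc ≤ klE5uM P R := (klEngU₀12_le_klEngU₀12Core P R cc).trans (klEngU₀12Core_le_klE5uM P R cc)

/-- `klEngU₀12 ≤ klE5ShareU2 P R (klEngQ9c P R) cc` (class #3). -/
theorem klEngU₀12_le_klE5ShareU2 : klEngU₀12 P R cc ≤ klE5ShareU2 P R (klEngQ9c P R) cc :=
  (klEngU₀12_le_klEngU₀12Core P R cc).trans (klEngU₀12Core_le_klE5ShareU2 P R cc)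

/-- `klEngU₀12 ≤ klTowerU P R (klEngQ9c P R) cc` (E1's tower). -/
theorem klEngU₀12_le_klTowerU : klEngU₀12 P R cc ≤ klTowerU P R (klEngQ9c P R) cc :=
  (klEngU₀12_le_klEngU₀12Core P R cc).trans (klEngU₀12Core_le_klTowerU P R cc)

/-- `klEngU₀12 ≤ klEngU₀9` (v1 door). -/
theorem klEngU₀12_le_klEngU₀9 : klEngU₀12 P R cc ≤ klEngU₀9 P R cc := (klEngU₀12_le_klEngU₀12Core P R cc).trans (klEngU₀12Core_le_klEngU₀9 P R cc)

/-- `klEngU₀12 ≤ klEngU₀3`. -/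
theorem klEngU₀12_le_klEngU₀3 : klEngU₀12 P R cc ≤ klEngU₀3 P R cc := (klEngU₀12_le_klEngU₀12Core P R cc).trans (klEngU₀12Core_le_klEngU₀3 P R cc)

variable {R}

/-- **`0 < klEngU₀12 P R cc`** under `P.WF`, `R.WF2` (arity as the image's §P3 placeholder: `klEngU₀12_pos P cc hP hR`). -/
theorem klEngU₀12_pos (hP : P.WF) (hR : R.WF2) : 0 < klEngU₀12 P R cc :=
  lt_min (klEngU₀12Core_pos cc hP hR)
    (lt_min (klIsoMomU_pos _ P R _ cc)
      (lt_min (klE4UF_pos _ P R _ cc)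
        (lt_min (klE5FrU_pos_of_wf klEngGeo11_wf hR)
          (lt_min (klCTu7_pos P R _ _ _ _ cc)
            (lt_min (klE5RowsU11_pos P R)
              (lt_min (klTSU_pos R) (lt_min (klLastRespU_pos P R) (lt_min (klZspU5_pos P R _ _ _ cc)
                (lt_min (klGridLitUAt_pos P R _ cc) (lt_min (klTwoLegMomU_pos hR.2.2 _ _)
                  (lt_min (by have := abs_nonneg (klZs2 P R); positivity) (lt_min (by have := klZs1_nonneg P R; have := hR.2.2; positivity)
                    (lt_min (by have := klZs1_nonneg P R; positivity) (lt_min (klGridU₀_pos hR.1) (lt_min (by have := klReadOscC_nonneg P R; positivity) (lt_min klTailBookU_pos (lt_min (klTowerUC_pos P R _ cc) (klTowerCoreUC9_pos P R _ cc))))))))))))))))))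

end Projections

end Summit.HubbardSuperconductivity.HubbardSuperconductivity.Theorems.EngineV8

end
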